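import Literature.MathematicalPhysics.QuantumFieldTheory.Federbush1986.NonAbelianDualityUNAnalytic

/-!
# `Federbush1986.NonAbelianDualityUNComplexAnalytic` — [Federbush1987PhaseCellVI] (13)–(17) p. 21 WITH COMPLEX VARIABLES, AS PRINTED,
# for Federbush's block-spin scheme on `G = U(N)` (every `N`): the logarithmic form `F` of the block spin is the restriction to real
# (skew-Hermitian) values of a function `FC` of the complexified variables, COMPLEX-analytic near `0`, the same for all admissible
# block-spin functions, with no constant term and linear term the abelian averaging of I

statement-level skeleton of published theorems with citation tags; proofs where landed; nothing here is a claim about the Yang–Mills mass gap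

CITATION HEADER.  P. Federbush, *A phase cell approach to Yang–Mills theory. VI. Non-abelian lattice-continuum duality*, Ann. Inst.
H. Poincaré (Physique théorique) **47** (1987) 17–23 [Federbush1987PhaseCellVI], p. 21 (render
`run/shared/lean/pub/pub-balaban/b2b-balaban-t4-lit-g16/renders/federbushVI/1987-aihp47-federbush-phase-cell-VI-nonabelian-duality-p005-x4.png`,
read as an image by this unit in gens 5–7; not in the lit store): *«We consider the situation when the g(e_α) are all close to the
identity. We write g(e) = e^{A(e)}, g(e_α) = e^{A(e_α)} (13) with the A(e_α), A(e) small. If G has rank r, we view each A(e_α) as a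
homogeneous linear function of r complex variables (real for actual values), and likewise A(e). Then the transformation from the g(e_α)
to g(e) may be viewed as given by r complex analytic functions (for the A(e_α) small enough). … The f_i are analytic for |z_l| < ε′. (17)
The functions f_i are the same for all such transformations. We also know that the f_i have no constant terms, and that the linear
terms are the same as in the Abelian theory treated in I.»*  P. Federbush, *… III*, Commun. Math. Phys. **110** (1987) 293–309
[Federbush1987PhaseCellIII], §1 Lemma 1.3 p. 295–296 (the averaging equation; Bałaban CMP **109** (0.10)).  lit-balaban cell (HOME
`run/shared/lean/pub/lit-balaban/`), unit `lit-balaban-r17` gen 14 (reader/typer r17 = fold owner of the Federbush rows; own Phase-2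
filing, free-target protocol G.5-34(d)), SKELETON row **F6.Eq13-18** (also F6.Eq19-23, F6.Thm1) of `HOME/lit-balaban-r17/SKELETON-r17.md`.
Inputs BY NAME, none edited: this unit's gen-7 `NonAbelianDualityUNAnalytic` ((17) in the REAL-analytic reading: `UN.karcherMap`,
`UNBlockSpinFunction.analyticOn_F`; its HONEST SCOPE (c): «COMPLEX analyticity of the complexified coordinates (here real analyticity,
the typed reading of `AnalyticStructure`)» — the gap closed here), `NonAbelianDualityUNScheme` (`UNBlockSpinFunction`, `.F`, `.F_zero`,
`.hasFDerivAt_F`, `.ofMinimizers`, `uNFL`, `UN.blockSpin_smallField`, `UN.logUN`/`expUN_logUN`/`norm_logUN_eq`/`norm_val_sub_one_le`,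
`UN.inv_expUN_val`, `uN.wordSum_val`), p12 gen 6's `UN.sum_mlog_rel_eq_zero_of_isPureAverage` (`PureAveragesUNLemma13`), `UN.skewProj` /
`skewProj_val` (gen 7), the matrix logarithm `MatrixLog.mlog` (`analyticAt_mlog` over `ℂ`, `B7BlockAvgLog.mlog_exp`), and Mathlib's analytic
implicit-function theorem over `ℂ` (`ContDiffAt.implicitFunction` with `𝕜 = ℂ`, `n = ω`).

WHAT IS PROVED (`G = U(N)`, every `N`; `𝔲(N) ⊗ ℂ = M_N(ℂ) =: 𝕄 N`):
* §C1 `UN.wordExpM Z Γ = Π e^{±Z_α}` — the word holonomy on COMPLEX matrices (reversed letter `e^{−Z_α}`); `UN.wordHol_expUN_val` (on real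
  values it is the group holonomy `g_Γ(e^{A})`), `UN.analyticAt_wordExpM` (`ℂ`-analytic in `Z`), `UN.wordExpM_zero`.
* §C2 the COMPLEX Karcher map `UN.karcherMapC (Z, x) = Σ_x log(e^{−x} g_{Γ_x}(e^{Z}))` (no projection to `𝔲(N)`): `ℂ`-analytic at
  `(0,0)` (`analyticAt_karcherMapC`), `K_ℂ(0, x) = −16x` near `0` (`karcherMapC_zero_left`), `∂_x K_ℂ(0,0) = −16·Id` invertible.
* §C3 **`UN.FC : (Fin 160 → 𝕄 N) → 𝕄 N`** — the implicit function of `K_ℂ = 0` at `(0,0)` over `ℂ` (independent of any block-spin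
  function: «The functions f_i are the same for all such transformations»); **`UN.eventually_analyticAt_FC`** / `UN.analyticAt_FC`
  ((17): `ℂ`-analytic on a neighbourhood of `0`), **`UN.FC_zero`** («no constant terms»), `UN.eventually_karcherMapC_FC`,
  `UN.eventually_karcherMapC_eq_zero_iff`; **`UNBlockSpinFunction.exists_F_val_eq_FC`**: for EVERY admissible block-spin function `B`
  there is `ε′ > 0` with `(B.F A) = FC(A)` as matrices whenever all `|A(e_α)| < ε′` ((14), «real for actual values»: on such data
  `e^{F(A)}` is the pure average, which satisfies the averaging equation (0.10) on matrices, and `(A, F(A))` lies in the uniqueness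
  neighbourhood);
  `UNBlockSpinFunction.exists_complexAnalytic_F` (packaged form: `∃ ε′ > 0, ∃ ψ`, `ℂ`-analytic on `‖Z‖ < ε′`, `ψ 0 = 0`, `F = ψ` on the reals).
* §C4 «the linear terms are the same as in the Abelian theory treated in I» FOR THE COMPLEX `f`: `UNBlockSpinFunction.fderiv_FC_apply_real`
  (`D(FC)(0)·A = F^L(A)` on real directions, from gen 7's `hasFDerivAt_F` and `F = FC`), `val_skewProj_add_I_smul` (every complex matrix is
  `X + iY` with `X, Y ∈ 𝔲(N)`: the real values span), and **`UNBlockSpinFunction.fderiv_FC_eq_FLC`**: `D(FC)(0) = FLC`, the abelian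
  averaging `Z ↦ (1/16) Σ_x Z_{Γ_x}` as a `ℂ`-linear map (`FLC`, `FLC_apply`, `FLC_valFam`).

HONEST SCOPE.  (a) Model instance `G = U(N)` with `𝔤_ℂ = M_N(ℂ)` as the complexification (print: «If G has rank r … r complex variables»
— print's «rank r» is read as `dim 𝔤`; here the complexified coordinates are the `N²` complex matrix entries of each `A(e_α)`, no basis `E^i`
of (15) is chosen).  (b) The radius `ε′` is that of Mathlib's implicit-function theorem (not quantified).  (c) Only the germ of `FC` at `0`
is asserted to mean anything; print's `f` is defined on real data by the block-spin function and extended here by the complex averaging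
equation.  (d) Row F6.Eq13-18 keeps its `typed` head under the block's rule G.1 (model instance).  Definitions with bodies: `UN.wordExpM`,
`UN.karcherMapC`, `UN.FC`, `UNBlockSpinFunction.valFam`, `UNBlockSpinFunction.FLC`; everything else is a theorem; no new named facts, no
`sorry`, axioms standard.  OUR proof of a claim print states without proof; not summit progress.
v1.1 (r17 gen 14; DOC-ONLY, declarations untouched): two locator slips «(16)» → (14) (print's (16) is the coordinate expansion A(e_α) =
Σ_j z_{iα(j)}E^j; the transformation is (14) w_i = f_i(z_1, …, z_{Mr})), and the docstring of `exists_F_val_eq_FC` now quotes p. 21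
verbatim.
-/

namespace Literature.MathematicalPhysics.QuantumFieldTheory.Federbush1986

noncomputable section

open Filter Metric Set NormedSpace
open scoped Topology Matrix.Norms.Frobenius ContDiff BigOperators
open Literature.MathematicalPhysics.QuantumFieldTheory.Balaban1983to89.MatrixLog (mlog mlog_def mlog_one exp_mlog
  analyticAt_mlog)
open Literature.MathematicalPhysics.QuantumFieldTheory.Balaban1983to89.B7BlockAvgLog (mlog_exp)

variable {N : ℕ}

namespace UN

/-! ## §C1 Word holonomies on complex matrices: `g_Γ(e^{Z}) = Π e^{±Z_α}` -/

/-- The holonomy (2) of a word in the exponentials `e^{Z_α}` of COMPLEX matrices `Z_α ∈ M_N(ℂ) = 𝔲(N) ⊗ ℂ` — a reversed letter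
contributes `e^{−Z_α}` («we view each A(e_α) as a homogeneous linear function of r complex variables (real for actual values)»).
[cite: Federbush1987PhaseCellVI, (2) p. 18, (13)–(16) p. 21] -/
def wordExpM {ι : Type*} (Z : ι → 𝕄 N) : List (ι × Bool) → 𝕄 N
  | [] => 1
  | (α, b) :: w => (if b then exp (Z α) else exp (-Z α)) * wordExpM Z w

/-- On REAL (skew-Hermitian) values the complex word holonomy is the group holonomy: `g_Γ(e^{A})` on matrices.
[cite: Federbush1987PhaseCellVI, (2) p. 18, (13) p. 21] -/
theorem wordHol_expUN_val {ι : Type*} (A : ι → uN N) :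
    ∀ w : List (ι × Bool), (wordHol (fun α => expUN (A α)) w).val = wordExpM (fun α => (A α).val) w
  | [] => by simp only [wordHol, wordExpM, one_val]
  | (α, b) :: w => by
    have ih := wordHol_expUN_val A w
    cases b
    · simp only [wordHol, wordExpM, Bool.false_eq_true, ↓reduceIte, mul_val, inv_expUN_val, ih]
    · simp only [wordHol, wordExpM, ↓reduceIte, mul_val, expUN_val, ih]

/-- At `Z = 0` every complex word holonomy is `1`. [cite: Federbush1987PhaseCellVI, (2) p. 18] -/
theorem wordExpM_zero {ι : Type*} : ∀ w : List (ι × Bool), wordExpM (0 : ι → 𝕄 N) w = 1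
  | [] => rfl
  | (α, b) :: w => by
    cases b <;> simp only [wordExpM, Bool.false_eq_true, ↓reduceIte, Pi.zero_apply, neg_zero, exp_zero, one_mul,
      wordExpM_zero w]

/-- The complex word holonomy is COMPLEX-analytic in the variables `Z` (products of `e^{±Z_α}`): «the transformation from the
g(e_α) to g(e) may be viewed as given by r complex analytic functions». [cite: Federbush1987PhaseCellVI, (13)–(17) p. 21] -/
theorem analyticAt_wordExpM (Z₀ : Fin 160 → 𝕄 N) :
    ∀ w : List (Fin 160 × Bool), AnalyticAt ℂ (fun Z : Fin 160 → 𝕄 N => wordExpM Z w) Z₀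
  | [] => by
    simp only [wordExpM]
    exact analyticAt_const
  | (α, b) :: w => by
    have ih := analyticAt_wordExpM Z₀ w
    have hlin : AnalyticAt ℂ (fun Z : Fin 160 → 𝕄 N => Z α) Z₀ :=
      (ContinuousLinearMap.proj (R := ℂ) α : (Fin 160 → 𝕄 N) →L[ℂ] 𝕄 N).analyticAt Z₀
    have hexp : AnalyticAt ℂ (fun Z : Fin 160 → 𝕄 N => exp (Z α)) Z₀ := (NormedSpace.exp_analytic _).fun_comp hlin
    have hexpn : AnalyticAt ℂ (fun Z : Fin 160 → 𝕄 N => exp (-Z α)) Z₀ :=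
      (NormedSpace.exp_analytic _).fun_comp hlin.fun_neg
    cases b
    · simp only [wordExpM, Bool.false_eq_true, ↓reduceIte]
      exact hexpn.fun_mul ih
    · simp only [wordExpM, ↓reduceIte]
      exact hexp.fun_mul ih

/-! ## §C2 The averaging equation (0.10) on COMPLEX matrices as a complex-analytic implicit equation -/

/-- **The complex Karcher map** `K_ℂ(Z, x) = Σ_x log(e^{−x} g_{Γ_x}(e^{Z}))` on `(M_N(ℂ))^{160} × M_N(ℂ)` (matrix logarithm (21); no
projection to `𝔲(N)` — on real data the sum is skew-Hermitian by itself). [cite: Federbush1987PhaseCellIII, Lemma 1.3 (1.12) p. 295–296;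
Federbush1987PhaseCellVI, (13)–(17) p. 21] -/
def karcherMapC (p : (Fin 160 → 𝕄 N) × 𝕄 N) : 𝕄 N :=
  ∑ x : Fin 16, mlog (exp (-p.2) * wordExpM p.1 (canonPaths x))

/-- **The complex Karcher map is COMPLEX-analytic at `(0, 0)`.** [cite: Federbush1987PhaseCellVI, (17) p. 21] -/
theorem analyticAt_karcherMapC : AnalyticAt ℂ (karcherMapC (N := N)) ((0 : Fin 160 → 𝕄 N), (0 : 𝕄 N)) := by
  unfold karcherMapC
  refine Finset.analyticAt_fun_sum _ fun x _ => ?_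
  have h2 : AnalyticAt ℂ (fun p : (Fin 160 → 𝕄 N) × 𝕄 N => exp (-p.2)) (0, 0) :=
    (NormedSpace.exp_analytic _).fun_comp ((ContinuousLinearMap.snd ℂ (Fin 160 → 𝕄 N) (𝕄 N)).analyticAt _).fun_neg
  have h1 : AnalyticAt ℂ (fun p : (Fin 160 → 𝕄 N) × 𝕄 N => wordExpM p.1 (canonPaths x)) (0, 0) :=
    (analyticAt_wordExpM 0 (canonPaths x)).fun_comp_of_eq
      ((ContinuousLinearMap.fst ℂ (Fin 160 → 𝕄 N) (𝕄 N)).analyticAt _) rfl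
  have hlog : AnalyticAt ℂ (mlog : 𝕄 N → 𝕄 N) 1 :=
    analyticAt_mlog (X := (1 : 𝕄 N)) (by rw [sub_self, norm_zero]; norm_num)
  refine hlog.fun_comp_of_eq (h2.fun_mul h1) ?_
  show exp (-(0 : 𝕄 N)) * wordExpM (0 : Fin 160 → 𝕄 N) (canonPaths x) = 1
  rw [wordExpM_zero, neg_zero, exp_zero, one_mul]

/-- On the slice `Z = 0`: `K_ℂ(0, x) = −16x` near `0`. [cite: Federbush1987PhaseCellIII, Lemma 1.3 p. 295–296] -/
theorem karcherMapC_zero_left : ∃ r > (0 : ℝ), ∀ x : 𝕄 N, ‖x‖ < r → karcherMapC (0, x) = (-16 : ℂ) • x := by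
  refine ⟨Real.log 2, Real.log_pos (by norm_num), fun x hx => ?_⟩
  unfold karcherMapC
  have hl : mlog (exp (-x)) = -x := mlog_exp (by rw [norm_neg]; exact hx)
  simp only [wordExpM_zero, mul_one, hl, Finset.sum_const, Finset.card_univ, Fintype.card_fin, smul_neg]
  rw [neg_smul, ← Nat.cast_smul_eq_nsmul ℂ]
  norm_num

/-- `K_ℂ(0, 0) = 0`. [cite: Federbush1987PhaseCellIII, Lemma 1.3 p. 295–296] -/
theorem karcherMapC_zero : karcherMapC ((0 : Fin 160 → 𝕄 N), (0 : 𝕄 N)) = 0 := by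
  obtain ⟨r, hr, h⟩ := karcherMapC_zero_left (N := N)
  rw [h 0 (by rwa [norm_zero]), smul_zero]

/-- The partial derivative of the complex Karcher map in `x` at the origin is `−16·Id`. [cite: Federbush1987PhaseCellIII, Lemma 1.3
p. 295–296] -/
theorem fderiv_karcherMapC_comp_inr (hK : DifferentiableAt ℂ (karcherMapC (N := N)) ((0 : Fin 160 → 𝕄 N), (0 : 𝕄 N))) :
    (fderiv ℂ karcherMapC ((0 : Fin 160 → 𝕄 N), (0 : 𝕄 N))).comp (ContinuousLinearMap.inr ℂ (Fin 160 → 𝕄 N) (𝕄 N)) =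
      (-16 : ℂ) • ContinuousLinearMap.id ℂ (𝕄 N) := by
  have h1 : HasFDerivAt (fun x : 𝕄 N => karcherMapC (0, x))
      ((fderiv ℂ karcherMapC ((0 : Fin 160 → 𝕄 N), (0 : 𝕄 N))).comp (ContinuousLinearMap.inr ℂ (Fin 160 → 𝕄 N) (𝕄 N))) 0 :=
    hK.hasFDerivAt.comp (0 : 𝕄 N) (hasFDerivAt_prodMk_right (0 : Fin 160 → 𝕄 N) (0 : 𝕄 N))
  have h2 : HasFDerivAt (fun x : 𝕄 N => karcherMapC (0, x)) ((-16 : ℂ) • ContinuousLinearMap.id ℂ (𝕄 N)) 0 := by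
    obtain ⟨r, hr, h⟩ := karcherMapC_zero_left (N := N)
    have heq : (fun x : 𝕄 N => (-16 : ℂ) • x) =ᶠ[𝓝 0] fun x : 𝕄 N => karcherMapC (0, x) :=
      Filter.eventually_of_mem (Metric.ball_mem_nhds (0 : 𝕄 N) hr) fun x hx => by
        rw [Metric.mem_ball, dist_zero_right] at hx
        exact (h x hx).symm
    exact (((ContinuousLinearMap.id ℂ (𝕄 N)).hasFDerivAt).const_smul (-16 : ℂ)).congr_of_eventuallyEq heq.symm
  exact h1.unique h2

/-- `−16·Id` is invertible. [cite: Federbush1987PhaseCellIII, Lemma 1.3 p. 295–296] -/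
theorem isInvertible_smul_idC : ((-16 : ℂ) • ContinuousLinearMap.id ℂ (𝕄 N)).IsInvertible := by
  refine ⟨ContinuousLinearEquiv.equivOfInverse ((-16 : ℂ) • ContinuousLinearMap.id ℂ (𝕄 N))
    ((-16 : ℂ)⁻¹ • ContinuousLinearMap.id ℂ (𝕄 N)) (fun x => ?_) (fun x => ?_), rfl⟩ <;>
  · simp [smul_smul]

/-- The sup norm of the matrices of a family is the sup norm of the family. [cite: Federbush1987PhaseCellVI, (19) p. 21] -/
theorem norm_val_family_le (A : Fin 160 → uN N) : ‖(fun α => (A α).val)‖ ≤ ‖A‖ :=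
  (pi_norm_le_iff_of_nonneg (norm_nonneg A)).mpr fun α => by rw [← uN.norm_def]; exact norm_le_pi_norm A α

end UN

/-! ## §C3 (17) WITH COMPLEX VARIABLES, as printed: the complex-analytic `f` defined by the averaging equation -/

namespace UN

/-- The complex Karcher map is `C^ω` (over `ℂ`) at the origin. [cite: Federbush1987PhaseCellVI, (17) p. 21] -/
theorem contDiffAt_karcherMapC : ContDiffAt ℂ ω (karcherMapC (N := N)) ((0 : Fin 160 → 𝕄 N), (0 : 𝕄 N)) :=
  analyticAt_karcherMapC.contDiffAt

/-- `∂_x K_ℂ(0,0)` is invertible. [cite: Federbush1987PhaseCellIII, Lemma 1.3 p. 295–296] -/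
theorem isInvertible_fderiv_karcherMapC_comp_inr :
    ((fderiv ℂ (karcherMapC (N := N)) ((0 : Fin 160 → 𝕄 N), (0 : 𝕄 N))).comp
      (ContinuousLinearMap.inr ℂ (Fin 160 → 𝕄 N) (𝕄 N))).IsInvertible := by
  rw [fderiv_karcherMapC_comp_inr (contDiffAt_karcherMapC.differentiableAt Literature.Analysis.Calculus.omega_ne_zero)]
  exact isInvertible_smul_idC

/-- **The complex-analytic block-spin function `f` of (13)–(17)**: the implicit function `Z ↦ x(Z)` of the complex averaging equation
`K_ℂ(Z, x) = 0` near `(0, 0)` (Mathlib's `ContDiffAt.implicitFunction` over `ℂ` at `n = ω`).  It depends on NO block-spin function: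
«The functions f_i are the same for all such transformations». [cite: Federbush1987PhaseCellVI, (13)–(17) p. 21] -/
def FC : (Fin 160 → 𝕄 N) → 𝕄 N :=
  (contDiffAt_karcherMapC (N := N)).implicitFunction Literature.Analysis.Calculus.omega_ne_zero
    isInvertible_fderiv_karcherMapC_comp_inr

/-- **(17) «The f_i are analytic for |z_l| < ε′» — COMPLEX-analytic, as printed**: `FC` is `ℂ`-analytic at every point of a
neighbourhood of `0`. [cite: Federbush1987PhaseCellVI, (17) p. 21] -/
theorem eventually_analyticAt_FC : ∀ᶠ Z in 𝓝 (0 : Fin 160 → 𝕄 N), AnalyticAt ℂ (FC (N := N)) Z :=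
  ((contDiffAt_karcherMapC (N := N)).contDiffAt_implicitFunction Literature.Analysis.Calculus.omega_ne_zero
    isInvertible_fderiv_karcherMapC_comp_inr).analyticAt.eventually_analyticAt

/-- `FC` is `ℂ`-analytic at `0`. [cite: Federbush1987PhaseCellVI, (17) p. 21] -/
theorem analyticAt_FC : AnalyticAt ℂ (FC (N := N)) 0 :=
  (eventually_analyticAt_FC (N := N)).self_of_nhds

/-- Near `(0, 0)` the zero set of `K_ℂ` is the graph of `FC`. [cite: Federbush1987PhaseCellIII, Lemma 1.3 p. 295–296] -/
theorem eventually_karcherMapC_eq_zero_iff :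
    ∀ᶠ v in 𝓝 ((0 : Fin 160 → 𝕄 N), (0 : 𝕄 N)), karcherMapC v = 0 ↔ FC v.1 = v.2 := by
  have h := (contDiffAt_karcherMapC (N := N)).eventually_apply_eq_iff_implicitFunction
    Literature.Analysis.Calculus.omega_ne_zero isInvertible_fderiv_karcherMapC_comp_inr
  rw [karcherMapC_zero] at h
  exact h

/-- «the f_i have no constant terms»: `FC 0 = 0`. [cite: Federbush1987PhaseCellVI, p. 21] -/
theorem FC_zero : FC (N := N) 0 = 0 := by
  have h := (eventually_karcherMapC_eq_zero_iff (N := N)).self_of_nhds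
  exact h.mp karcherMapC_zero

/-- `FC` solves the complex averaging equation near `0`: `K_ℂ(Z, FC Z) = 0`. [cite: Federbush1987PhaseCellIII, Lemma 1.3 (1.12)
p. 295–296] -/
theorem eventually_karcherMapC_FC : ∀ᶠ Z in 𝓝 (0 : Fin 160 → 𝕄 N), karcherMapC (Z, FC Z) = 0 := by
  have h := (contDiffAt_karcherMapC (N := N)).eventually_apply_implicitFunction
    Literature.Analysis.Calculus.omega_ne_zero isInvertible_fderiv_karcherMapC_comp_inr
  rw [karcherMapC_zero] at h
  exact h

end UN

namespace UNBlockSpinFunction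

/-- **(14)/(17) for every admissible block-spin function on `U(N)`: `F = FC` on the real (skew-Hermitian) values near `0`** —
«Thus the block spin transformation, as it yields g(e), is given as w_i = f_i(z_1, …, z_{Mr}) i = 1, …, r (14) … The f_i are
analytic for |z_l| < ε′. (17) The functions f_i are the same for all such transformations» (with «(real for actual values)» above):
there is `ε′ > 0` with `F(A) = FC(A)` (as matrices) whenever all `|A(e_α)| < ε′`.  Proof
(ours): on such data `e^{F(A)}` is the pure average of the word holonomies, so the averaging equation (0.10)
`Σ_x log(e^{−F(A)} g_{Γ_x}) = 0` holds on matrices (p12's `UN.sum_mlog_rel_eq_zero_of_isPureAverage`), i.e. `K_ℂ(A, F(A)) = 0`, and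
`(A, F(A))` lies in the uniqueness neighbourhood of the implicit function. [cite: Federbush1987PhaseCellVI, (13)–(17) p. 21;
Federbush1987PhaseCellIII, §1 Lemma 1.3 p. 295–296] -/
theorem exists_F_val_eq_FC (B : UNBlockSpinFunction N) :
    ∃ ε' > (0 : ℝ), ∀ A : Fin 160 → uN N, (∀ α, ‖A α‖ < ε') → (B.F A).val = UN.FC (fun α => (A α).val) := by
  obtain ⟨ρ₂, hρ₂, huniq'⟩ := Metric.eventually_nhds_iff.mp (UN.eventually_karcherMapC_eq_zero_iff (N := N))
  set δ₀ : ℝ := min (min (B.ε / 11) (1 / 25000)) (ρ₂ / 53) with hδ₀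
  have hδ₀pos : 0 < δ₀ := by
    rw [hδ₀]; exact lt_min (lt_min (by linarith [B.ε_pos]) (by norm_num)) (by linarith)
  refine ⟨δ₀, hδ₀pos, fun A hA' => ?_⟩
  have hA : ‖A‖ < δ₀ := (pi_norm_lt_iff hδ₀pos).mpr hA'
  have h1 : ‖A‖ < B.ε / 11 := lt_of_lt_of_le hA (by rw [hδ₀]; exact (min_le_left _ _).trans (min_le_left _ _))
  have h2 : ‖A‖ < 1 / 25000 := lt_of_lt_of_le hA (by rw [hδ₀]; exact (min_le_left _ _).trans (min_le_right _ _))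
  have h4 : ‖A‖ < ρ₂ / 53 := lt_of_lt_of_le hA (by rw [hδ₀]; exact min_le_right _ _)
  by_cases hA0 : A = 0
  · subst hA0
    rw [B.F_zero, uN.zero_val]
    have e : (fun α => ((0 : Fin 160 → uN N) α).val) = (0 : Fin 160 → UN.𝕄 N) := by
      funext α; rw [Pi.zero_apply, uN.zero_val]; rfl
    rw [e, UN.FC_zero]
  have hApos : 0 < ‖A‖ := norm_pos_iff.mpr hA0
  obtain ⟨hword, hbar, hΦ1⟩ := UN.blockSpin_smallField B.Φ B.pure canonPaths length_canonPaths_le A ‖A‖ hApos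
    (by linarith) (fun i => norm_le_pi_norm A i) (by linarith [B.ε_pos])
  set gs : Fin 16 → UN N := fun x => wordHol (fun i => expUN (A i)) (canonPaths x) with hgs
  set x₀ : uN N := B.F A with hx₀
  have hΦd : dist 1 (B.Φ gs) ≤ 1 / 64 := hΦ1.trans (by linarith)
  have hΦc : ‖(B.Φ gs).val - 1‖ < 1 / 4 := (UN.norm_val_sub_one_le _).trans_lt (by linarith)
  have hex₀ : expUN x₀ = B.Φ gs := by rw [hx₀]; exact UN.expUN_logUN hΦc
  have hx₀n : ‖x₀‖ ≤ 52 * ‖A‖ := by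
    rw [hx₀]; show ‖UN.logUN (B.Φ gs)‖ ≤ _; rw [UN.norm_logUN_eq hΦd]; exact hΦ1
  have hstep : ∀ x, UN.stepSize (B.Φ gs) (gs x) < 1 / 200 := fun x => by
    rw [← UN.norm_val_sub_val]
    calc ‖(gs x).val - (B.Φ gs).val‖ ≤ 2 * dist (gs x) (B.Φ gs) := UN.norm_val_sub_val_le_two_mul_dist _ _
      _ ≤ 2 * (dist (gs x) 1 + dist 1 (B.Φ gs)) := by gcongr; exact dist_triangle _ _ _
      _ ≤ 2 * (10 * ‖A‖ + 52 * ‖A‖) := by rw [dist_comm]; gcongr; exact (hword x).1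
      _ < 1 / 200 := by linarith
  have hsum : ∑ x, mlog (UN.rel (B.Φ gs) (gs x)) = 0 := UN.sum_mlog_rel_eq_zero_of_isPureAverage hstep hbar
  have hrel : ∀ x, exp (-x₀.val) * UN.wordExpM (fun α => (A α).val) (canonPaths x) = UN.rel (B.Φ gs) (gs x) := fun x => by
    rw [← UN.wordHol_expUN_val, UN.rel_def, ← hex₀, ← UN.inv_expUN_val, UN.inv_val]
  have hKA : UN.karcherMapC ((fun α => (A α).val), x₀.val) = 0 := by
    show ∑ x, mlog (exp (-x₀.val) * UN.wordExpM (fun α => (A α).val) (canonPaths x)) = 0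
    simp only [hrel]
    exact hsum
  have hdist : dist ((fun α => (A α).val), x₀.val) ((0 : Fin 160 → UN.𝕄 N), (0 : UN.𝕄 N)) < ρ₂ := by
    rw [Prod.dist_eq, dist_zero_right, dist_zero_right]
    refine max_lt (lt_of_le_of_lt (UN.norm_val_family_le A) (by linarith)) ?_
    rw [← uN.norm_def]
    calc ‖x₀‖ ≤ 52 * ‖A‖ := hx₀n
      _ < ρ₂ := by linarith
  exact ((huniq' hdist).mp hKA).symm

/-- **(13)–(17) AS PRINTED (complex variables), packaged**: an `ε′ > 0` and a function `ψ` of the complexified variables, `ℂ`-analytic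
on `‖Z‖ < ε′`, vanishing at `0`, whose restriction to real values is `F` on `|A(e_α)| < ε′`. [cite: Federbush1987PhaseCellVI,
(13)–(17) p. 21] -/
theorem exists_complexAnalytic_F (B : UNBlockSpinFunction N) :
    ∃ ε' > (0 : ℝ), ∃ ψ : (Fin 160 → UN.𝕄 N) → UN.𝕄 N,
      (∀ Z : Fin 160 → UN.𝕄 N, ‖Z‖ < ε' → AnalyticAt ℂ ψ Z) ∧ ψ 0 = 0 ∧
        ∀ A : Fin 160 → uN N, (∀ α, ‖A α‖ < ε') → (B.F A).val = ψ (fun α => (A α).val) := by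
  obtain ⟨ρ₁, hρ₁, han⟩ := Metric.eventually_nhds_iff.mp (UN.eventually_analyticAt_FC (N := N))
  obtain ⟨δ₀, hδ₀, hF⟩ := B.exists_F_val_eq_FC
  refine ⟨min δ₀ ρ₁, lt_min hδ₀ hρ₁, UN.FC, fun Z hZ => han (by rw [dist_zero_right]; exact lt_of_lt_of_le hZ (min_le_right _ _)),
    UN.FC_zero, fun A hA => hF A fun α => lt_of_lt_of_le (hA α) (min_le_left _ _)⟩

/-! ## §C4 «the linear terms are the same as in the Abelian theory treated in I»: the complex derivative of `FC` at `0` on real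
directions is `F^L` -/

/-- The real-linear embedding `A ↦ (A(e_α))_α` of the real variables into the complexified ones (as matrices).
[cite: Federbush1987PhaseCellVI, (13) p. 21] -/
def valFam : (Fin 160 → uN N) →L[ℝ] (Fin 160 → UN.𝕄 N) :=
  ContinuousLinearMap.pi fun α => (UN.valL (N := N)).comp (ContinuousLinearMap.proj (R := ℝ) α)

/-- [cite: Federbush1987PhaseCellVI, (13) p. 21] -/
@[simp] theorem valFam_apply (A : Fin 160 → uN N) : valFam A = fun α => (A α).val := rfl

/-- **The linear term of the complex `f` is the abelian average**: for every real direction `A`,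
`D(FC)(0)·A = F^L(A) = (1/16) Σ_x A_{Γ_x}` — the complex derivative restricted to `𝔲(N)^{160}` is I's abelian averaging (`uNFL`;
r17 gen 7's `hasFDerivAt_F`), since `FC = F` on the real values near `0`. [cite: Federbush1987PhaseCellVI, p. 21 «the linear terms are
the same as in the Abelian theory treated in I»; Federbush1986PhaseCellI, (1.1)–(1.3) p. 322] -/
theorem fderiv_FC_apply_real (A : Fin 160 → uN N) :
    fderiv ℂ (UN.FC (N := N)) 0 (fun α => (A α).val) = (uNFL A).val := by
  -- any admissible block-spin function will do: `F = FC` near `0` on the reals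
  set B : UNBlockSpinFunction N := ofMinimizers with hB
  obtain ⟨ε', hε', hF⟩ := B.exists_F_val_eq_FC
  -- the real map `A ↦ FC (A)` and its derivative by the chain rule
  have hFC : HasFDerivAt (UN.FC (N := N)) (fderiv ℂ UN.FC 0) (valFam (0 : Fin 160 → uN N)) := by
    rw [map_zero]; exact UN.analyticAt_FC.differentiableAt.hasFDerivAt
  have h1 : HasFDerivAt (fun A : Fin 160 → uN N => UN.FC (valFam A))
      (((fderiv ℂ (UN.FC (N := N)) 0).restrictScalars ℝ).comp valFam) 0 :=
    (hFC.restrictScalars ℝ).comp (0 : Fin 160 → uN N) valFam.hasFDerivAt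
  -- the real map `A ↦ (F A).val` and its derivative
  have h2 : HasFDerivAt (fun A : Fin 160 → uN N => (B.F A).val) ((UN.valL (N := N)).comp uNFL) 0 :=
    (UN.valL (N := N)).hasFDerivAt.comp (0 : Fin 160 → uN N) B.hasFDerivAt_F
  -- they agree near `0`
  have heq : (fun A : Fin 160 → uN N => UN.FC (valFam A)) =ᶠ[𝓝 0] fun A => (B.F A).val := by
    filter_upwards [Metric.ball_mem_nhds (0 : Fin 160 → uN N) hε'] with A hA
    rw [Metric.mem_ball, dist_zero_right] at hA
    rw [valFam_apply, ← hF A fun α => lt_of_le_of_lt (norm_le_pi_norm A α) hA]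
  have h := (h1.congr_of_eventuallyEq heq.symm).unique h2
  have := congrArg (fun L => L A) h
  simp only [ContinuousLinearMap.coe_comp, Function.comp_apply, ContinuousLinearMap.coe_restrictScalars', valFam_apply,
    UN.valL_apply] at this
  exact this

/-- Signed word sums of continuous linear maps evaluate letterwise (any index type, any scalars).
[cite: Federbush1986PhaseCellI, (1.1)–(1.2) p. 322] -/
theorem wordSum_clm_apply_gen {𝕜 : Type*} [NontriviallyNormedField 𝕜] {E G : Type*} [NormedAddCommGroup E] [NormedSpace 𝕜 E]
    [NormedAddCommGroup G] [NormedSpace 𝕜 G] {ι : Type*} (a : ι → (E →L[𝕜] G)) (x : E) :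
    ∀ w : List (ι × Bool), (wordSum a w) x = wordSum (fun b => a b x) w
  | [] => rfl
  | (b, s) :: w => by
    cases s <;> simp only [wordSum, Bool.false_eq_true, ↓reduceIte, add_apply, neg_apply, wordSum_clm_apply_gen a x w]

/-- **The abelian averaging of I on the COMPLEXIFIED variables**, `Z ↦ (1/16) Σ_x Z_{Γ_x}`, as a `ℂ`-linear map («the linear terms
are the same as in the Abelian theory treated in I»). [cite: Federbush1987PhaseCellVI, p. 21; Federbush1986PhaseCellI, (1.1)–(1.3) p. 322] -/
def FLC : (Fin 160 → UN.𝕄 N) →L[ℂ] UN.𝕄 N :=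
  (16 : ℂ)⁻¹ • ∑ x : Fin 16, wordSum (fun α => (ContinuousLinearMap.proj (R := ℂ) α : (Fin 160 → UN.𝕄 N) →L[ℂ] UN.𝕄 N))
    (canonPaths x)

/-- `FLC Z = (1/16) Σ_x Z_{Γ_x}`. [cite: Federbush1986PhaseCellI, (1.1)–(1.3) p. 322] -/
theorem FLC_apply (Z : Fin 160 → UN.𝕄 N) : FLC Z = (16 : ℂ)⁻¹ • ∑ x : Fin 16, wordSum Z (canonPaths x) := by
  rw [FLC, smul_apply, sum_apply]
  exact congrArg _ (Finset.sum_congr rfl fun x _ => wordSum_clm_apply_gen _ _ _)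

/-- On real values `FLC` is `F^L` (as matrices). [cite: Federbush1986PhaseCellI, (1.1)–(1.3) p. 322; Federbush1987PhaseCellVI, p. 21] -/
theorem FLC_valFam (A : Fin 160 → uN N) : FLC (fun α => (A α).val) = (uNFL A).val := by
  rw [FLC_apply, uNFL_apply, UN.val_smul, uN.sum_val]
  simp only [uN.wordSum_val]
  rw [RCLike.real_smul_eq_coe_smul (K := ℂ)]
  norm_num

/-- Every complex matrix is `X + iY` with `X, Y` skew-Hermitian: `Z = ½(Z − Z^*) + i·(−(i/2)(Z + Z^*))` — the real values span the
complexified variables. [cite: Federbush1987PhaseCellVI, (13)–(15) p. 21 «r complex variables (real for actual values)»] -/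
theorem val_skewProj_add_I_smul (Z : UN.𝕄 N) :
    (UN.skewProj Z).val + Complex.I • (UN.skewProj (-(Complex.I • Z))).val = Z := by
  rw [UN.skewProj_val, UN.skewProj_val, star_neg, star_smul, Complex.star_def, Complex.conj_I]
  ext i j
  simp only [Matrix.add_apply, Matrix.smul_apply, Matrix.sub_apply, Matrix.neg_apply, smul_eq_mul]
  ring_nf
  rw [Complex.I_sq]
  ring

/-- **«the linear terms are the same as in the Abelian theory treated in I» for the COMPLEX `f`**: the complex derivative of `FC`
at `0` IS the abelian averaging on the complexified variables, `D(FC)(0) = (Z ↦ (1/16) Σ_x Z_{Γ_x})`.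
[cite: Federbush1987PhaseCellVI, p. 21; Federbush1986PhaseCellI, (1.1)–(1.3) p. 322] -/
theorem fderiv_FC_eq_FLC : fderiv ℂ (UN.FC (N := N)) 0 = FLC := by
  apply ContinuousLinearMap.ext
  intro Z
  set X : Fin 160 → uN N := fun α => UN.skewProj (Z α) with hX
  set Y : Fin 160 → uN N := fun α => UN.skewProj (-(Complex.I • Z α)) with hY
  have hZ : Z = (fun α => (X α).val) + Complex.I • fun α => (Y α).val := by
    funext α
    rw [Pi.add_apply, Pi.smul_apply, hX, hY]
    exact (val_skewProj_add_I_smul (Z α)).symm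
  rw [hZ, map_add, map_smul, map_add, map_smul, fderiv_FC_apply_real, fderiv_FC_apply_real, FLC_valFam, FLC_valFam]

end UNBlockSpinFunction

end

end Literature.MathematicalPhysics.QuantumFieldTheory.Federbush1986
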